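import Literature.NumberTheory.Automorphic.ArchInnerFormChartOrbitalSmooth     -- ★ p850500∕p850509 (F0P3a-p05 (g20)): the non-parametric head, §2 (HYP) on `RegG`, `contDiffOn_archRG_regG`
import Literature.MeasureTheory.Group.QuotientOrbitalIntegralProperSmoothParam     -- ★ p850850 (HYP-PARAM): `contDiffOn_integral_descConj_of_uniformlyProper_param_local`
import HarnessLib

/-!
# The chart orbital functional `chartOrbG` of a SMOOTH FAMILY of test functions is `C^∞` jointly in (coordinates, parameter) «(CHART-PARAM)»

Topic `NumberTheory/Automorphic`; namespace `Literature.NumberTheory.Automorphic.UnitaryGroup` (§1) and `Literature.NumberTheory.Rogawski1990` (§2).  THEOREMS ONLY (no `def`,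
no instance, no notation, no axiom, no named fact, no `sorry`).  Cell `pub/hodgecm-mathlib`, crux H413 (`stmt-HodgeConjecture-24833`), line LH3 (closer stub `stub_N9`, leaf v4
`Cruxes/H413/Lines/F0_P3c_StubN9Direct.lean`), LETTER L1 clause (I₂) — the PARAMETRIC twin of ★ p850500 §3 `contDiffOn_chartOrbG_of_uniformlyProper` (F0P3a-p05 (g20))
over ★ (HYP-PARAM) p850850: the «parametric re-run of ★ p850547 §4» item of F0P3b-p01 (g16)'s census `CENSUS-I2-corners.v1.md` §4 for the §4 places-induction of RULING #12
(LH3-plan (g3) word 2026-09-02 «(CHART-PARAM) = F0P3a-p02 (g20)»).  Count-neutral.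

THE MATHEMATICS.  `G′_∞ = U(diag α)(L ⊗ ℝ)`, `S′` a chart label, `T_{S′} = chartTorusG α S′`, `γ′(c) = gprimeTorus α S′ c` the atlas, `U` an open set of coordinates on which the
atlas is uniformly proper modulo `T_{S′}` (the (HYP) binder of ★ p850500 VERBATIM).  Let `a′ : Z → G′_∞ → ℂ` be a family of test functions on a finite-dimensional real
parameter space `Z`, with ONE ambient smooth lift `Θ : Z × M₃(L ⊗ ℝ) → ℂ` (`a′ z k = Θ (z, k)`) and vanishing off one compact `C′ ⊆ G′_∞` for `z` in an open `T ⊆ Z`.  Then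
`(c, z) ↦ chartOrbG ν′ S′ (a′ z) c` is `C^∞` on `U ×ˢ T`: p05's commutant-projection factorisation `a′ z (y · γ′(c) · y⁻¹) = Θ (z, ∑ₖ ℓₖ(γ′(c)) • Ad(y) bₖ)` (`bₖ` a basis of
the commutant of `T_{S′}` in `M₃(L ⊗ ℝ)`, `ℓₖ` the coordinate functionals of a linear projection onto it) is a smooth factorisation `Ψ (p y, (c, z))` in the sense of ★
(HYP-PARAM), and `contDiffOn_integral_descConj_of_uniformlyProper_param_local` differentiates under the quotient integral (Hörmander).
* §1 **`contDiffOn_chartOrbG_of_uniformlyProper_param`** (the head, (HYP)-binder form), `…_regG_param` (on `RegG S′ ×ˢ T` for admissible `S′`, via ★ §2 of p850500),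
  `contDiffOn_chartOrbG_param_of_uniformlyProper` (parameter alone at a fixed `c ∈ U`);
* §2 the ordinary orbital family: `contDiffOn_orbFamG_of_uniformlyProper_param`, `contDiffOn_orbFamG_regG_param` (`orbFamG = archRG · chartOrbG`, ★ `orbFamG_apply`,
  ★ `contDiffOn_archRG_regG`).
HONEST LABEL: letter-L1 pay-down plumbing only (count-neutral); HC_CM is proved only modulo the printed citations (2 remaining named inputs: hLiu418 = `stmt-HodgeConjecture-24832`,
h413 = `stmt-HodgeConjecture-24833`) until rung 0 closes.

## References
* [Rogawski1990] J. D. Rogawski, *Automorphic Representations of Unitary Groups in Three Variables*, Ann. of Math. Stud. 123 (1990), §8.3 pp. 122–124 (smoothness of orbital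
  integrals on the regular set), §4.12 Lemma 4.12.1 p. 66.
* [Shelstad1979] D. Shelstad, *Characters and inner forms of a quasi-split group over ℝ*, Compositio Math. 39 (1979), §4 pp. 22–23.
* [Varadarajan1989] V. S. Varadarajan, *An Introduction to Harmonic Analysis on Semisimple Lie Groups* (1989), §2.4 Thm. 8.
* [HormanderALPDO1] L. Hörmander, *The Analysis of Linear Partial Differential Operators I* (1990), §1.1 Thm. 1.1.9 (p. 12).
-/

set_option autoImplicit false

noncomputable section

open MeasureTheory Matrix NumberField NumberField.InfinitePlace NumberField.mixedEmbedding Set Function Topology Complex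
open Literature.MeasureTheory.Group Literature.NumberTheory.Rogawski1990 Literature.NumberTheory.Automorphic.ArchCartan
open Literature.NumberTheory.Automorphic.UnitaryGroup
open scoped MatrixGroups ContDiff Classical
open scoped Matrix.Norms.Operator

namespace Literature.NumberTheory.Automorphic.UnitaryGroup

/-! ## §1 The head: `(c, z) ↦ chartOrbG ν′ S′ (a′ z) c` is `C^∞` on `U ×ˢ T` wherever the atlas is uniformly proper -/

section HeadParam

variable (L : Type) [Field L] [NumberField L] [IsCMField L] (α : Fin 3 → L)
  [MeasurableSpace ↥(arch (↥(maximalRealSubfield L)) L (IsCMField.complexConj L) 3 (Matrix.diagonal α))]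
  [BorelSpace ↥(arch (↥(maximalRealSubfield L)) L (IsCMField.complexConj L) 3 (Matrix.diagonal α))]
  (ν' : Measure ↥(arch (↥(maximalRealSubfield L)) L (IsCMField.complexConj L) 3 (Matrix.diagonal α))) [IsFiniteMeasureOnCompacts ν'] [ν'.IsMulRightInvariant]
  (S' : Finset {w : InfinitePlace L // IsComplex w})
  {Z : Type*} [NormedAddCommGroup Z] [NormedSpace ℝ Z] [FiniteDimensional ℝ Z]

/-- **(CHART-PARAM), (HYP)-BINDER FORM.** For a family of test functions `a′ : Z → G′_∞ → ℂ` with one ambient smooth lift `Θ : Z × M₃(L ⊗ ℝ) → ℂ` and uniform compact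
support over an open parameter set `T`, the chart orbital functional `(c, z) ↦ chartOrbG ν′ S′ (a′ z) c` is `C^∞` on `U ×ˢ T` for every open `U` of coordinates on which the
atlas `gprimeTorus α S′` is uniformly proper modulo `T_{S′}` (binder = ★ p850500's, verbatim).  Differentiation under the quotient integral via ★ (HYP-PARAM) with p05's
commutant-projection factorisation. [cite: Rogawski1990, §8.3 pp. 122–124] [cite: Shelstad1979, §4 pp. 22–23] [cite: Varadarajan1989, §2.4 Thm. 8] [cite: HormanderALPDO1, §1.1 Thm. 1.1.9 (p. 12)] -/
theorem contDiffOn_chartOrbG_of_uniformlyProper_param {U : Set ({w : InfinitePlace L // IsComplex w} → Fin 3 → ℝ)} (hU : IsOpen U)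
    (hprop : ∀ K ⊆ U, IsCompact K →
      ∀ C' : Set ↥(arch (↥(maximalRealSubfield L)) L (IsCMField.complexConj L) 3 (Matrix.diagonal α)), IsCompact C' →
        ∃ 𝒦' : Set (↥(arch (↥(maximalRealSubfield L)) L (IsCMField.complexConj L) 3 (Matrix.diagonal α)) ⧸ chartTorusG L α S'),
          IsCompact 𝒦' ∧ ∀ c ∈ K, ∀ y' : ↥(arch (↥(maximalRealSubfield L)) L (IsCMField.complexConj L) 3 (Matrix.diagonal α)),
            y' * gprimeTorus L α S' c * y'⁻¹ ∈ C' →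
              (QuotientGroup.mk y' : ↥(arch (↥(maximalRealSubfield L)) L (IsCMField.complexConj L) 3 (Matrix.diagonal α)) ⧸ chartTorusG L α S') ∈ 𝒦')
    {T : Set Z} (hT : IsOpen T) {a' : Z → ↥(arch (↥(maximalRealSubfield L)) L (IsCMField.complexConj L) 3 (Matrix.diagonal α)) → ℂ} {C' : Set ↥(arch (↥(maximalRealSubfield L)) L (IsCMField.complexConj L) 3 (Matrix.diagonal α))} (hC' : IsCompact C') (ha'C' : ∀ z ∈ T, ∀ k ∉ C', a' z k = 0)
    (Θ : Z × Matrix (Fin 3) (Fin 3) (mixedSpace L) → ℂ) (hΘ : ContDiff ℝ ∞ Θ)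
    (ha'Θ : ∀ z k, a' z k = Θ (z, ((k : GL (Fin 3) (mixedSpace L)) : Matrix (Fin 3) (Fin 3) (mixedSpace L)))) :
    ContDiffOn ℝ ∞ (fun q : ({w : InfinitePlace L // IsComplex w} → Fin 3 → ℝ) × Z => chartOrbG L α ν' S' (a' q.2) q.1) (U ×ˢ T) := by
  letI : MeasurableSpace (↥(arch (↥(maximalRealSubfield L)) L (IsCMField.complexConj L) 3 (Matrix.diagonal α)) ⧸ chartTorusG L α S') := borel _
  haveI : BorelSpace (↥(arch (↥(maximalRealSubfield L)) L (IsCMField.complexConj L) 3 (Matrix.diagonal α)) ⧸ chartTorusG L α S') := ⟨rfl⟩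
  haveI : IsFiniteMeasureOnCompacts (chartQuotientMeasureG L α ν' S') := by
    unfold chartQuotientMeasureG
    infer_instance
  haveI : IsClosed (chartTorusG L α S' : Set ↥(arch (↥(maximalRealSubfield L)) L (IsCMField.complexConj L) 3 (Matrix.diagonal α))) := isClosed_chartTorusG L α S'
  -- the ambient reading `G′_∞ → M₃(L ⊗ ℝ)`
  let Ebar : ↥(arch (↥(maximalRealSubfield L)) L (IsCMField.complexConj L) 3 (Matrix.diagonal α)) → Matrix (Fin 3) (Fin 3) (mixedSpace L) :=
    fun k => ((k : GL (Fin 3) (mixedSpace L)) : Matrix (Fin 3) (Fin 3) (mixedSpace L))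
  have hEmul : ∀ x y, Ebar (x * y) = Ebar x * Ebar y := fun x y => by
    simp only [Ebar, Subgroup.coe_mul, Units.val_mul]
  have hEone : Ebar 1 = 1 := by simp only [Ebar, OneMemClass.coe_one, Units.val_one]
  have hEinv : ∀ x, Ebar x * Ebar x⁻¹ = 1 := fun x => by rw [← hEmul, mul_inv_cancel, hEone]
  have hEcont : Continuous Ebar := Units.continuous_val.comp continuous_subtype_val
  -- the commutant of `T_{S′}` in `M₃(L ⊗ ℝ)` and a linear projection onto it
  let A : Submodule ℝ (Matrix (Fin 3) (Fin 3) (mixedSpace L)) :=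
    { carrier := {m | ∀ s ∈ chartTorusG L α S', Ebar s * m = m * Ebar s}
      add_mem' := fun {a b} ha hb s hs => by rw [mul_add, add_mul, ha s hs, hb s hs]
      zero_mem' := fun s _ => by rw [mul_zero, zero_mul]
      smul_mem' := fun r m hm s hs => by
        show Ebar s * (r • m) = r • m * Ebar s
        rw [mul_smul_comm, smul_mul_assoc, hm s hs] }
  have hAmem : ∀ m, m ∈ A ↔ ∀ s ∈ chartTorusG L α S', Ebar s * m = m * Ebar s := fun _ => Iff.rfl
  obtain ⟨B, hAB⟩ := A.exists_isCompl
  -- a basis of the commutant and its coordinate functionals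
  let b := Module.finBasis ℝ A
  let ℓ : Fin (Module.finrank ℝ A) → Matrix (Fin 3) (Fin 3) (mixedSpace L) →ₗ[ℝ] ℝ := fun k => (b.coord k) ∘ₗ (A.projectionOnto B hAB)
  have hℓ : ∀ k, ContDiff ℝ ∞ fun m : Matrix (Fin 3) (Fin 3) (mixedSpace L) => ℓ k m := fun k =>
    (LinearMap.toContinuousLinearMap (ℓ k)).contDiff
  have hrec : ∀ m ∈ A, ∑ k, ℓ k m • ((b k : A) : Matrix (Fin 3) (Fin 3) (mixedSpace L)) = m := by
    intro m hm
    have h1 : A.projectionOnto B hAB m = ⟨m, hm⟩ := Submodule.projectionOnto_apply_of_mem_left hAB hm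
    have h2 := congrArg (fun x : A => (x : Matrix (Fin 3) (Fin 3) (mixedSpace L))) (b.sum_repr (⟨m, hm⟩ : A))
    simp only [AddSubmonoidClass.coe_finsetSum, SetLike.val_smul] at h2
    have h3 : ∀ k, ℓ k m = b.repr (⟨m, hm⟩ : A) k := fun k => by
      show b.coord k (A.projectionOnto B hAB m) = _
      rw [h1, Module.Basis.coord_apply]
    simp only [h3]
    exact h2
  -- the `T_{S′}`-invariant datum `p(y) = (Ad(y) b_k)_k`
  let p : ↥(arch (↥(maximalRealSubfield L)) L (IsCMField.complexConj L) 3 (Matrix.diagonal α)) → Fin (Module.finrank ℝ A) → Matrix (Fin 3) (Fin 3) (mixedSpace L) :=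
    fun h k => Ebar h * ((b k : A) : Matrix (Fin 3) (Fin 3) (mixedSpace L)) * Ebar h⁻¹
  have hp : Continuous p :=
    continuous_pi fun k => (hEcont.mul continuous_const).mul (hEcont.comp continuous_inv)
  have hpM : ∀ y, ∀ m ∈ chartTorusG L α S', p (y * m) = p y := by
    intro y s hs
    funext k
    have hc : Ebar s * ((b k : A) : Matrix (Fin 3) (Fin 3) (mixedSpace L)) = ((b k : A) : Matrix (Fin 3) (Fin 3) (mixedSpace L)) * Ebar s :=
      (hAmem _).1 (b k).2 s hs
    show Ebar (y * s) * ((b k : A) : Matrix (Fin 3) (Fin 3) (mixedSpace L)) * Ebar (y * s)⁻¹ =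
      Ebar y * ((b k : A) : Matrix (Fin 3) (Fin 3) (mixedSpace L)) * Ebar y⁻¹
    rw [_root_.mul_inv_rev, hEmul, hEmul]
    calc Ebar y * Ebar s * ((b k : A) : Matrix (Fin 3) (Fin 3) (mixedSpace L)) * (Ebar s⁻¹ * Ebar y⁻¹)
        = Ebar y * (Ebar s * ((b k : A) : Matrix (Fin 3) (Fin 3) (mixedSpace L)) * Ebar s⁻¹) * Ebar y⁻¹ := by simp only [mul_assoc]
      _ = Ebar y * ((b k : A) : Matrix (Fin 3) (Fin 3) (mixedSpace L)) * Ebar y⁻¹ := by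
          rw [hc, mul_assoc (((b k : A) : Matrix (Fin 3) (Fin 3) (mixedSpace L))), hEinv, mul_one]
  -- the smooth factorisation `Ψ (m, (c, z)) = Θ (z, ∑_k ℓ_k(γ′(c)) • m_k)`
  let Ψ : (Fin (Module.finrank ℝ A) → Matrix (Fin 3) (Fin 3) (mixedSpace L)) × (({w : InfinitePlace L // IsComplex w} → Fin 3 → ℝ) × Z) → ℂ :=
    fun q => Θ (q.2.2, ∑ k, ℓ k (Ebar (gprimeTorus L α S' q.2.1)) • q.1 k)
  have hΨ : ContDiff ℝ ∞ Ψ := by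
    refine hΘ.comp ((contDiff_snd.comp contDiff_snd).prodMk (ContDiff.sum fun k _ => ?_))
    have h1 : ContDiff ℝ ∞ fun q : (Fin (Module.finrank ℝ A) → Matrix (Fin 3) (Fin 3) (mixedSpace L)) × (({w : InfinitePlace L // IsComplex w} → Fin 3 → ℝ) × Z) =>
        ℓ k (Ebar (gprimeTorus L α S' q.2.1)) :=
      (hℓ k).comp ((contDiff_coe_gprimeTorus L α S').comp (contDiff_fst.comp contDiff_snd))
    have h2 : ContDiff ℝ ∞ fun q : (Fin (Module.finrank ℝ A) → Matrix (Fin 3) (Fin 3) (mixedSpace L)) × (({w : InfinitePlace L // IsComplex w} → Fin 3 → ℝ) × Z) =>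
        q.1 k := (contDiff_apply ℝ (Matrix (Fin 3) (Fin 3) (mixedSpace L)) k).comp contDiff_fst
    exact h1.smul h2
  have hfac : ∀ z y c, a' z (y * gprimeTorus L α S' c * y⁻¹) = Ψ (p y, (c, z)) := by
    intro z y c
    have hmem : Ebar (gprimeTorus L α S' c) ∈ A := fun s hs => by
      rw [← hEmul, ← hEmul, forall_mem_chartTorusG_comm L α S' c s hs]
    have hsum : ∑ k, ℓ k (Ebar (gprimeTorus L α S' c)) • p y k =
        Ebar y * (∑ k, ℓ k (Ebar (gprimeTorus L α S' c)) • ((b k : A) : Matrix (Fin 3) (Fin 3) (mixedSpace L))) * Ebar y⁻¹ := by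
      rw [Finset.mul_sum, Finset.sum_mul]
      exact Finset.sum_congr rfl fun k _ => by rw [mul_smul_comm, smul_mul_assoc]
    show a' z _ = Θ (z, ∑ k, ℓ k (Ebar (gprimeTorus L α S' c)) • p y k)
    rw [hsum, hrec _ hmem, ← hEmul, ← hEmul]
    exact ha'Θ z _
  have h := Literature.MeasureTheory.Group.contDiffOn_integral_descConj_of_uniformlyProper_param_local (chartTorusG L α S')
    (forall_mem_chartTorusG_comm L α S') hU hprop (chartQuotientMeasureG L α ν' S') hT hC' ha'C' p hp hpM Ψ hΨ hfac
  -- `chartOrbG = const • quotient integral` (★ `chartOrbG_def`), read through `funext` with the right side INFERRED (a hand-written right side makes the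
  -- elaborator unfold `chartOrbG` on the product domain)
  rw [show (fun q : ({w : InfinitePlace L // IsComplex w} → Fin 3 → ℝ) × Z => chartOrbG L α ν' S' (a' q.2) q.1) = _ from
    funext fun q => chartOrbG_def L α ν' S' (a' q.2) q.1]
  exact contDiffOn_const.mul h

/-- **(CHART-PARAM) on the regular set of an admissible chart**: `(c, z) ↦ chartOrbG ν′ S′ (a′ z) c` is `C^∞` on `RegG S′ ×ˢ T` (★ §2 of p850500 supplies (HYP)).
[cite: Rogawski1990, §8.3 pp. 122–124; §4.12 Lemma 4.12.1 p. 66] [cite: Varadarajan1989, §2.4 Thm. 8] -/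
theorem contDiffOn_chartOrbG_regG_param (hα : ∀ i, α i ≠ 0) (hS' : ∀ w, w ∈ S' → w ∈ splitChartPlaces L α)
    {T : Set Z} (hT : IsOpen T) {a' : Z → ↥(arch (↥(maximalRealSubfield L)) L (IsCMField.complexConj L) 3 (Matrix.diagonal α)) → ℂ} {C' : Set ↥(arch (↥(maximalRealSubfield L)) L (IsCMField.complexConj L) 3 (Matrix.diagonal α))} (hC' : IsCompact C') (ha'C' : ∀ z ∈ T, ∀ k ∉ C', a' z k = 0)
    (Θ : Z × Matrix (Fin 3) (Fin 3) (mixedSpace L) → ℂ) (hΘ : ContDiff ℝ ∞ Θ)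
    (ha'Θ : ∀ z k, a' z k = Θ (z, ((k : GL (Fin 3) (mixedSpace L)) : Matrix (Fin 3) (Fin 3) (mixedSpace L)))) :
    ContDiffOn ℝ ∞ (fun q : ({w : InfinitePlace L // IsComplex w} → Fin 3 → ℝ) × Z => chartOrbG L α ν' S' (a' q.2) q.1) (RegG S' ×ˢ T) :=
  contDiffOn_chartOrbG_of_uniformlyProper_param L α ν' S' (isOpen_regG S') (uniformlyProper_gprimeTorus_chartTorusG_regG L α S' hα hS') hT hC' ha'C' Θ hΘ ha'Θ

/-- **(CHART-PARAM), parameter alone**: at a fixed coordinate point `c ∈ U` the map `z ↦ chartOrbG ν′ S′ (a′ z) c` is `C^∞` on `T`.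
[cite: Rogawski1990, §8.3 pp. 122–124] [cite: HormanderALPDO1, §1.1 Thm. 1.1.9 (p. 12)] -/
theorem contDiffOn_chartOrbG_param_of_uniformlyProper {U : Set ({w : InfinitePlace L // IsComplex w} → Fin 3 → ℝ)} (hU : IsOpen U)
    (hprop : ∀ K ⊆ U, IsCompact K →
      ∀ C' : Set ↥(arch (↥(maximalRealSubfield L)) L (IsCMField.complexConj L) 3 (Matrix.diagonal α)), IsCompact C' →
        ∃ 𝒦' : Set (↥(arch (↥(maximalRealSubfield L)) L (IsCMField.complexConj L) 3 (Matrix.diagonal α)) ⧸ chartTorusG L α S'),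
          IsCompact 𝒦' ∧ ∀ c ∈ K, ∀ y' : ↥(arch (↥(maximalRealSubfield L)) L (IsCMField.complexConj L) 3 (Matrix.diagonal α)),
            y' * gprimeTorus L α S' c * y'⁻¹ ∈ C' →
              (QuotientGroup.mk y' : ↥(arch (↥(maximalRealSubfield L)) L (IsCMField.complexConj L) 3 (Matrix.diagonal α)) ⧸ chartTorusG L α S') ∈ 𝒦')
    {T : Set Z} (hT : IsOpen T) {a' : Z → ↥(arch (↥(maximalRealSubfield L)) L (IsCMField.complexConj L) 3 (Matrix.diagonal α)) → ℂ} {C' : Set ↥(arch (↥(maximalRealSubfield L)) L (IsCMField.complexConj L) 3 (Matrix.diagonal α))} (hC' : IsCompact C') (ha'C' : ∀ z ∈ T, ∀ k ∉ C', a' z k = 0)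
    (Θ : Z × Matrix (Fin 3) (Fin 3) (mixedSpace L) → ℂ) (hΘ : ContDiff ℝ ∞ Θ)
    (ha'Θ : ∀ z k, a' z k = Θ (z, ((k : GL (Fin 3) (mixedSpace L)) : Matrix (Fin 3) (Fin 3) (mixedSpace L))))
    {c : {w : InfinitePlace L // IsComplex w} → Fin 3 → ℝ} (hc : c ∈ U) :
    ContDiffOn ℝ ∞ (fun z : Z => chartOrbG L α ν' S' (a' z) c) T := by
  have h := contDiffOn_chartOrbG_of_uniformlyProper_param L α ν' S' hU hprop hT hC' ha'C' Θ hΘ ha'Θ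
  have hmaps : MapsTo (fun z : Z => (c, z)) T (U ×ˢ T) := fun z hz => ⟨hc, hz⟩
  -- restrict along `z ↦ (c, z)` with the functional ABSTRACTED (keeps the elaborator from unfolding `chartOrbG`)
  have key : ∀ Φ : ({w : InfinitePlace L // IsComplex w} → Fin 3 → ℝ) → Z → ℂ,
      ContDiffOn ℝ ∞ (fun q : ({w : InfinitePlace L // IsComplex w} → Fin 3 → ℝ) × Z => Φ q.1 q.2) (U ×ˢ T) → ContDiffOn ℝ ∞ (fun z => Φ c z) T :=
    fun Φ hΦ => hΦ.comp (contDiffOn_const.prodMk contDiffOn_id) hmaps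
  exact key (fun c z => chartOrbG L α ν' S' (a' z) c) h

end HeadParam

end Literature.NumberTheory.Automorphic.UnitaryGroup

/-! ## §2 The ordinary orbital family of a smooth family of test functions -/

namespace Literature.NumberTheory.Rogawski1990

section FamilyParam

variable (L : Type) [Field L] [NumberField L] [IsCMField L] (α : Fin 3 → L)
  [MeasurableSpace ↥(arch (↥(maximalRealSubfield L)) L (IsCMField.complexConj L) 3 (Matrix.diagonal α))]
  [BorelSpace ↥(arch (↥(maximalRealSubfield L)) L (IsCMField.complexConj L) 3 (Matrix.diagonal α))]
  (ν' : Measure ↥(arch (↥(maximalRealSubfield L)) L (IsCMField.complexConj L) 3 (Matrix.diagonal α))) [IsFiniteMeasureOnCompacts ν'] [ν'.IsMulRightInvariant]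
  {Z : Type*} [NormedAddCommGroup Z] [NormedSpace ℝ Z] [FiniteDimensional ℝ Z]

/-- **The ordinary orbital family of a smooth family of test functions is `C^∞` jointly** wherever the atlas is uniformly proper inside `RegG S′` ((HYP)-binder form):
`orbFamG ν′ (a′ z) S′ c = archRG S′ c · chartOrbG ν′ S′ (a′ z) c` (★ `orbFamG_apply`) with ★ `contDiffOn_archRG_regG` and §1.
[cite: Shelstad1979, §4 p. 22] [cite: Rogawski1990, §8.3 pp. 122–124] -/
theorem contDiffOn_orbFamG_of_uniformlyProper_param (S' : Finset {w : InfinitePlace L // IsComplex w}) (hS' : ∀ w, w ∈ S' → w ∈ splitChartPlaces L α)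
    {U : Set ({w : InfinitePlace L // IsComplex w} → Fin 3 → ℝ)} (hU : IsOpen U) (hUreg : U ⊆ RegG S')
    (hprop : ∀ K ⊆ U, IsCompact K →
      ∀ C' : Set ↥(arch (↥(maximalRealSubfield L)) L (IsCMField.complexConj L) 3 (Matrix.diagonal α)), IsCompact C' →
        ∃ 𝒦' : Set (↥(arch (↥(maximalRealSubfield L)) L (IsCMField.complexConj L) 3 (Matrix.diagonal α)) ⧸ chartTorusG L α S'),
          IsCompact 𝒦' ∧ ∀ c ∈ K, ∀ y' : ↥(arch (↥(maximalRealSubfield L)) L (IsCMField.complexConj L) 3 (Matrix.diagonal α)),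
            y' * gprimeTorus L α S' c * y'⁻¹ ∈ C' →
              (QuotientGroup.mk y' : ↥(arch (↥(maximalRealSubfield L)) L (IsCMField.complexConj L) 3 (Matrix.diagonal α)) ⧸ chartTorusG L α S') ∈ 𝒦')
    {T : Set Z} (hT : IsOpen T) {a' : Z → ↥(arch (↥(maximalRealSubfield L)) L (IsCMField.complexConj L) 3 (Matrix.diagonal α)) → ℂ} {C' : Set ↥(arch (↥(maximalRealSubfield L)) L (IsCMField.complexConj L) 3 (Matrix.diagonal α))} (hC' : IsCompact C') (ha'C' : ∀ z ∈ T, ∀ k ∉ C', a' z k = 0)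
    (Θ : Z × Matrix (Fin 3) (Fin 3) (mixedSpace L) → ℂ) (hΘ : ContDiff ℝ ∞ Θ)
    (ha'Θ : ∀ z k, a' z k = Θ (z, ((k : GL (Fin 3) (mixedSpace L)) : Matrix (Fin 3) (Fin 3) (mixedSpace L)))) :
    ContDiffOn ℝ ∞ (fun q : ({w : InfinitePlace L // IsComplex w} → Fin 3 → ℝ) × Z => orbFamG L α ν' (a' q.2) S' q.1) (U ×ˢ T) := by
  have hEq : (fun q : ({w : InfinitePlace L // IsComplex w} → Fin 3 → ℝ) × Z => orbFamG L α ν' (a' q.2) S' q.1) =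
      fun q => archRG S' q.1 * chartOrbG L α ν' S' (a' q.2) q.1 := funext fun q => orbFamG_apply L α ν' (a' q.2) hS' q.1
  rw [hEq]
  refine ContDiffOn.mul ?_ (contDiffOn_chartOrbG_of_uniformlyProper_param L α ν' S' hU hprop hT hC' ha'C' Θ hΘ ha'Θ)
  exact ((contDiffOn_archRG_regG S').mono hUreg).comp contDiffOn_fst fun q hq => (mem_prod.1 hq).1

/-- **«(I₂-RegG-G′)» FOR A SMOOTH FAMILY**: on an admissible label `S′`, `(c, z) ↦ orbFamG ν′ (a′ z) S′ c` is `C^∞` on `RegG S′ ×ˢ T`.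
[cite: Shelstad1979, §4 pp. 22–23] [cite: Rogawski1990, §8.3 pp. 122–124] [cite: Varadarajan1989, §2.4 Thm. 8] -/
theorem contDiffOn_orbFamG_regG_param (S' : Finset {w : InfinitePlace L // IsComplex w}) (hα : ∀ i, α i ≠ 0) (hS' : ∀ w, w ∈ S' → w ∈ splitChartPlaces L α)
    {T : Set Z} (hT : IsOpen T) {a' : Z → ↥(arch (↥(maximalRealSubfield L)) L (IsCMField.complexConj L) 3 (Matrix.diagonal α)) → ℂ} {C' : Set ↥(arch (↥(maximalRealSubfield L)) L (IsCMField.complexConj L) 3 (Matrix.diagonal α))} (hC' : IsCompact C') (ha'C' : ∀ z ∈ T, ∀ k ∉ C', a' z k = 0)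
    (Θ : Z × Matrix (Fin 3) (Fin 3) (mixedSpace L) → ℂ) (hΘ : ContDiff ℝ ∞ Θ)
    (ha'Θ : ∀ z k, a' z k = Θ (z, ((k : GL (Fin 3) (mixedSpace L)) : Matrix (Fin 3) (Fin 3) (mixedSpace L)))) :
    ContDiffOn ℝ ∞ (fun q : ({w : InfinitePlace L // IsComplex w} → Fin 3 → ℝ) × Z => orbFamG L α ν' (a' q.2) S' q.1) (RegG S' ×ˢ T) :=
  contDiffOn_orbFamG_of_uniformlyProper_param L α ν' S' hS' (isOpen_regG S') subset_rfl (uniformlyProper_gprimeTorus_chartTorusG_regG L α S' hα hS')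
    hT hC' ha'C' Θ hΘ ha'Θ

end FamilyParam

end Literature.NumberTheory.Rogawski1990

end
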